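import Literature.AlgebraicGeometry.Resolution.RegularLocusPerfectField
import Literature.AlgebraicGeometry.Smoothening.NeronDefect
import Mathlib.RingTheory.Flat.Stability
import Mathlib.RingTheory.Valuation.ValuationSubring
import HarnessLib

/-!
# Regular at the centre ⇒ flat along the valuation ring
# (crux `IndSmooth.SmoothToUniformizing`, line `birth`, stub `stub_flatOfRegularCentre`)

Stub `stub_flatOfRegularCentre` of the skeleton `Lines/birth.lean` for crux
stmt-ResolutionOfSingularities-16088, the CONVERSE of the valuative Jacobian criterion
`stub_valuativeJacobian` (`IndSmoothSmoothToUniformizingValuativeJacobian.lean`). Setting: `k` a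
perfect field, `K/k` a field, `O` a valuation subring of `K`, `B ⊆ O` a finitely generated
`k`-subalgebra of `K` (the structure map `B → O` being the inclusion: any
`[Algebra B O] [IsScalarTower B O K]`), `𝔭 = 𝔪_O ∩ B` the centre of `O` on `B`.
**If `B_𝔭` is a regular local ring, then `O ⊗_B Ω[B⁄k]` is flat over `O`.**

Proof (the elementary half ⟸ of Bosch–Lütkebohmert–Raynaud, *Néron Models*, Lemma 3.3/1, with
the discrete valuation ring replaced by the valuation ring `O`):

1. `B` is of finite type over the PERFECT field `k` and `B_𝔭` is regular, so `B` is smooth over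
   `k` at `𝔭`, i.e. `B_𝔭` is formally smooth over `k`
   (`isSmoothAt_iff_isRegularLocalRing_of_perfectField`, Matsumura §30 Remark 2); hence
   `Ω[B_𝔭⁄k]` is a projective `B_𝔭`-module (Mathlib's definition of formal smoothness).
2. The point `B → O` factors through `B_𝔭` (elements of `B ∖ 𝔭` become units of the local ring
   `O`), so `O ⊗_{B_𝔭} Ω[B_𝔭⁄k]` is a base change of a projective, hence flat, module: flat.
3. Differentials commute with localization: `O ⊗_B Ω[B⁄k] ≃ₗ[O] O ⊗_{B_𝔭} Ω[B_𝔭⁄k]`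
   (`tensorKaehlerEquivOfIsLocalization`), and flatness transports along the isomorphism.
-/

noncomputable section

-- single-problem summit: the doubled namespace component `ResolutionOfSingularities` is forced
set_option linter.dupNamespace false

open scoped TensorProduct
open IsLocalRing Literature.AlgebraicGeometry.Smoothening Literature.AlgebraicGeometry.Resolution

namespace Summit.ResolutionOfSingularities.ResolutionOfSingularities.Theorems.IndSmoothBirth

/-- **Stub `stub_flatOfRegularCentre` (line `birth`): regular at the centre ⇒ flat along the
valuation ring.** For a perfect field `k`, a valuation subring `O` of a field `K ⊇ k`, and a
finitely generated `k`-subalgebra `B ⊆ O` of `K` (structure map `B → O` the inclusion), if `B`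
is regular at the centre `𝔭 = 𝔪_O ∩ B` of `O` then `O ⊗_B Ω[B⁄k]` is flat over `O`: over the
perfect field `k`, regular at `𝔭` = smooth at `𝔭`, so `Ω[B_𝔭⁄k]` is projective, its base
change to `O` (through which `B → O` factors) is flat, and `O ⊗_B Ω[B⁄k] ≅ O ⊗_{B_𝔭} Ω[B_𝔭⁄k]`.
BLR Lemma 3.3/1 ⟸ with the discrete valuation ring replaced by the valuation ring `O`.
[cite: Artin1986NeronModels, (3.8) (p. 226)] -/
theorem stub_flatOfRegularCentre (k K : Type) [Field k] [PerfectField k] [Field K] [Algebra k K]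
    (O : ValuationSubring K) (B : Subalgebra k K) (h : B.toSubring ≤ O.toSubring) (hB : B.FG)
    [Algebra B O] [IsScalarTower B O K]
    (hreg : IsRegularLocalRing (Localization.AtPrime
      (Ideal.comap (Subring.inclusion h) (IsLocalRing.maximalIdeal O)))) :
    Module.Flat O (TensorProduct B O (KaehlerDifferential k B)) := by
  classical
  -- (1) the structure map `B → O` is the inclusion; the centre `𝔭` as an ideal of `↥B`
  have hmap : ∀ b : B, algebraMap B O b = Subring.inclusion h b := fun b => by
    apply Subtype.ext
    have h1 : algebraMap B K b = algebraMap O K (algebraMap B O b) :=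
      IsScalarTower.algebraMap_apply _ _ _ b
    exact h1.symm
  let 𝔭 : Ideal B := Ideal.comap (Subring.inclusion h) (IsLocalRing.maximalIdeal O)
  haveI h𝔭p : 𝔭.IsPrime := Ideal.comap_isPrime _ _
  haveI hregp : IsRegularLocalRing (Localization.AtPrime 𝔭) := hreg
  have h𝔭 : (maximalIdeal O).comap (algebraMap B O) = 𝔭 := by
    ext b
    change algebraMap B O b ∈ maximalIdeal O ↔ Subring.inclusion h b ∈ maximalIdeal O
    rw [hmap]
  -- (2) `B` is of finite type over the perfect field `k`, so regular at `𝔭` ⇒ smooth at `𝔭`,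
  -- and `Ω[B_𝔭⁄k]` is projective
  haveI hft : Algebra.FiniteType k B := B.fg_iff_finiteType.mp hB
  haveI hsm : Algebra.IsSmoothAt k 𝔭 :=
    (isSmoothAt_iff_isRegularLocalRing_of_perfectField k B 𝔭).mpr hregp
  haveI : Module.Projective (Localization.AtPrime 𝔭) Ω[Localization.AtPrime 𝔭⁄k] :=
    inferInstance
  -- (3) the point `B → O` factors through `B_𝔭`: `B ∖ 𝔭` maps to units of the local ring `O`
  have hunits : ∀ y : 𝔭.primeCompl, IsUnit (algebraMap B O y) := fun y => by
    by_contra hy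
    have hy' : (y : B) ∈ (maximalIdeal O).comap (algebraMap B O) :=
      Ideal.mem_comap.mpr ((mem_maximalIdeal _).mpr (mem_nonunits_iff.mpr hy))
    exact Ideal.mem_primeCompl_iff.mp y.2 (h𝔭.le hy')
  letI algLO : Algebra (Localization.AtPrime 𝔭) O :=
    (IsLocalization.lift (M := 𝔭.primeCompl) (g := algebraMap B O) hunits).toAlgebra
  have hLO : ∀ b : B,
      algebraMap (Localization.AtPrime 𝔭) O (algebraMap B (Localization.AtPrime 𝔭) b) =
        algebraMap B O b :=
    fun b => IsLocalization.lift_eq (M := 𝔭.primeCompl) hunits b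
  haveI : IsScalarTower B (Localization.AtPrime 𝔭) O :=
    IsScalarTower.of_algebraMap_eq (R := B) (S := Localization.AtPrime 𝔭) (A := O)
      fun b => (hLO b).symm
  -- (4) base change of the projective `Ω[B_𝔭⁄k]` to `O` is flat; transport along
  -- `O ⊗_B Ω[B⁄k] ≃ O ⊗_{B_𝔭} Ω[B_𝔭⁄k]`
  haveI : Module.Flat (Localization.AtPrime 𝔭) Ω[Localization.AtPrime 𝔭⁄k] :=
    Module.Flat.of_projective
  haveI : Module.Flat O (O ⊗[Localization.AtPrime 𝔭] Ω[Localization.AtPrime 𝔭⁄k]) :=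
    Module.Flat.baseChange (Localization.AtPrime 𝔭) O Ω[Localization.AtPrime 𝔭⁄k]
  exact Module.Flat.of_linearEquiv
    (tensorKaehlerEquivOfIsLocalization k B (Localization.AtPrime 𝔭) 𝔭.primeCompl O)

end Summit.ResolutionOfSingularities.ResolutionOfSingularities.Theorems.IndSmoothBirth

end
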